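import Mathlib
import Summits.NavierStokesRegularity.NavierStokesRegularity.Theorems.TaoLadderRungTwoBreakBlowupRigidityOneEternalLawClosure
import HarnessLib

/-!
# SHIFT-COMPACTNESS OF BOUNDED ADMISSIBLE ETERNAL SOLUTIONS: ω-limits of shell / log-time translates of a
  uniformly bounded admissible eternal solution are again bounded solutions of the eternal law with the
  action bound, and — under a two-sided geometric energy envelope — again ADMISSIBLE (`IsEternal`) —
  the compactness step of the classification stub `stub_eternalIsDSS` of K2(1)
  `TaoLadderRungTwoBreak.BlowupRigidityOne` (stmt-NavierStokesRegularity-20206)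

MODEL lattice ODEs only (Tao 2016 §4 (4.8) in the self-similar log-time variables of §6.4; cell vocabulary
`IsEternal` / `UniformBound`); nothing here is a statement about the Navier–Stokes equations; NO item is closed
(`--supports stmt-NavierStokesRegularity-20206`). Route-independent; general number of modes `m`; DEF-FREE.

After `…PeriodicCompanion{,Bounded,Links}` (p819377, p819433, p819519) the classification stub reads: a
forward-surviving admissible eternal solution has a uniformly bounded SHIFT-PERIODIC surviving companion — a
periodic point of the translation dynamics `(n, σ) ↦ (n + d, σ + s)` on the class of bounded admissible eternal
solutions. This file supplies the COMPACTNESS half of any such ω-limit argument, for ETERNAL inputs (the sister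
files `…TypeIEternalLimit` / `…AdmissibleEternalLimit` of the g0 hand do the same for renormalised FLOWS on
receding half-lines):

* `eternal_lipschitz` — a uniformly bounded (`‖W_n(σ)‖ ≤ C`) solution of the eternal law is `K(C)`-Lipschitz in
  log-time on every shell (`K(C)` = the field bound `norm_eternalLaw_rhs_le`);
* `eternalLimit_of_uniformBound` — **COMPACTNESS**: for ANY centres `d_j ∈ ℤ`, `s_j ∈ ℝ`, a subsequence of the
  translates `W_{n+d_j}(u + s_j)` converges continuously to some `W∞` that solves the law of `IsEternal ε₀ α` at
  every log-time, obeys `‖W∞_n(σ)‖ ≤ C`, and inherits the ACTION clause with the same constant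
  (`∫_ℝ ‖W∞_n‖ ≤ M`: dominated convergence on windows + monotone exhaustion); a floor `δ ≤ ‖W_{d_j}(s_j)‖` at
  the centres gives `δ ≤ ‖W∞_0(0)‖` (non-triviality);
* `admissibleEternalLimit_of_envelope` — if moreover `W` has a TWO-SIDED geometric energy envelope
  `e^{2σ}‖W_n(σ)‖² ≤ Cₑ θ^n` (every admissible DSS wave has one, `θ = e^{2T}`) and the centres keep
  `θ^{d_j} e^{-2 s_j} ≤ M'` (front-following), the limit is ADMISSIBLE: `IsEternal ε₀ α W∞ ∧ UniformBound W∞`,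
  with envelope `Cₑ M' θ^n`.

What does NOT pass to such limits without further input: forward SURVIVAL (`EternalSurvivingFwd`) — the named
risk «compactness modulo shell shift may lose forward survival in the limit» of the route file; it needs floors
recurring in bounded windows of the centres (cf. `survivingFwd_of_firingLimit` for flows).

HONEST LABEL: analysis bookkeeping (Arzelà–Ascoli reuse of the ⟨22744⟩ kit `exists_subseq_continuousLimit` +
the landed closure `eternalLaw_of_continuousLimit`); nothing is proved about robust blow-up or about the
existence of periodic points; no stub, crux or summit is proved; rung 0.
-/

noncomputable section

-- the summit and its single sub-problem share the name (CONVENTIONS §1)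
set_option linter.dupNamespace false

open Set Filter Topology MeasureTheory

namespace Summit.NavierStokesRegularity.NavierStokesRegularity.Theorems

namespace BlowupRigidityOne

open Literature.Analysis.FluidPDE Literature.Analysis.FluidPDE.TaoCascade
open Summit.NavierStokesRegularity.NavierStokesRegularity.Cruxes.MinimalBlowupExtraction.Extraction
  (exists_subseq_continuousLimit)

variable {m : ℕ}

/-- **A uniformly bounded solution of the eternal law is Lipschitz in log-time on every shell**, with the
constant `K(C) = C + s₀₀₀C² + |Λ|s₀₀₁C² + |Λ⁻¹|(s₁₀₀+s₀₁₀)C²` of `norm_eternalLaw_rhs_le` (mean-value inequality).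
[cite: Tao2016AveragedNS, §4 Lemma 4.1 (iii) (4.8) in self-similar variables; Teschl2012, §2.6; cell vocabulary] -/
theorem eternal_lipschitz {ε₀ : ℝ} {α : Fin m → Fin m → Fin m → ℤ × ℤ × ℤ → ℝ} {W : ℤ → ℝ → Em m}
    (hlaw : ∀ (n : ℤ) (σ : ℝ), HasDerivAt (W n)
      (-((1 : ℝ) • W n σ) + tableQ α (W n σ) + bigLam ε₀ • tableA α (W (n - 1) σ)
        + (bigLam ε₀)⁻¹ • tableB α (W (n + 1) σ) (W n σ)) σ)
    {C : ℝ} (hC : ∀ (n : ℤ) (σ : ℝ), ‖W n σ‖ ≤ C) (n : ℤ) (u v : ℝ) :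
    ‖W n v - W n u‖ ≤
      (C + shiftConst α (0, 0, 0) * C ^ 2 + ‖bigLam ε₀‖ * (shiftConst α (0, 0, 1) * C ^ 2)
        + ‖(bigLam ε₀)⁻¹‖ * ((shiftConst α (1, 0, 0) + shiftConst α (0, 1, 0)) * C * C)) * |v - u| := by
  have hC0 : 0 ≤ C := (norm_nonneg _).trans (hC 0 0)
  have h := Convex.norm_image_sub_le_of_norm_hasDerivWithin_le (s := Set.univ) (x := u) (y := v)
    (f := W n)
    (f' := fun σ => -((1 : ℝ) • W n σ) + tableQ α (W n σ) + bigLam ε₀ • tableA α (W (n - 1) σ)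
        + (bigLam ε₀)⁻¹ • tableB α (W (n + 1) σ) (W n σ))
    (fun σ _ => (hlaw n σ).hasDerivWithinAt)
    (fun σ _ => norm_eternalLaw_rhs_le ε₀ α hC0 (hC n σ) (hC (n - 1) σ) (hC (n + 1) σ))
    convex_univ (mem_univ _) (mem_univ _)
  rw [Real.norm_eq_abs] at h
  exact h

/-- **SHIFT-COMPACTNESS OF BOUNDED ADMISSIBLE ETERNAL SOLUTIONS.** Let `W` be an admissible eternal solution of
the renormalised lattice of `α` (`IsEternal ε₀ α W`) with `‖W_n(σ)‖ ≤ C`. For every choice of shell centres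
`d_j ∈ ℤ` and log-time centres `s_j ∈ ℝ` there are a subsequence `φ` and `W∞ : ℤ → ℝ → ℝ^m` such that the
translates `W_{n+d_{φ j}}(u + s_{φ j})` converge CONTINUOUSLY to `W∞`, `W∞` solves the law of `IsEternal ε₀ α`
at every `σ`, `‖W∞_n(σ)‖ ≤ C`, the ACTION clause passes with the constant of `W`
(`∫_ℝ ‖W∞_n‖ ≤ M` for the `M` of `W`), and floors at the centres pass to the limit
(`(∀ j, δ ≤ ‖W_{d_j}(s_j)‖) → δ ≤ ‖W∞_0(0)‖`).
[cite: Tao2016AveragedNS, §4 Lemma 4.1 (iii) (4.8), §6.4; KochNadirashviliSereginSverak2009, Thm 1.1 ff. (rescaling-compactness shape); Teschl2012, §2.6; cell vocabulary (`IsEternal`, `UniformBound`)] -/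
theorem eternalLimit_of_uniformBound {ε₀ : ℝ} {α : Fin m → Fin m → Fin m → ℤ × ℤ × ℤ → ℝ}
    {W : ℤ → ℝ → Em m} (hW : IsEternal ε₀ α W) {C : ℝ} (hC : ∀ (n : ℤ) (σ : ℝ), ‖W n σ‖ ≤ C)
    (d : ℕ → ℤ) (s : ℕ → ℝ) :
    ∃ φ : ℕ → ℕ, StrictMono φ ∧ ∃ Wlim : ℤ → ℝ → Em m,
      (∀ (n : ℤ) (u : ℕ → ℝ) (σ : ℝ), Tendsto u atTop (𝓝 σ) →
        Tendsto (fun j => W (n + d (φ j)) (u j + s (φ j))) atTop (𝓝 (Wlim n σ))) ∧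
      (∀ (n : ℤ) (σ : ℝ), HasDerivAt (Wlim n) (-((1 : ℝ) • Wlim n σ) + tableQ α (Wlim n σ)
        + bigLam ε₀ • tableA α (Wlim (n - 1) σ) + (bigLam ε₀)⁻¹ • tableB α (Wlim (n + 1) σ) (Wlim n σ)) σ) ∧
      (∀ (n : ℤ) (σ : ℝ), ‖Wlim n σ‖ ≤ C) ∧
      (∀ M : ℝ, (∀ n : ℤ, Integrable (fun σ => ‖W n σ‖) ∧ ∫ σ, ‖W n σ‖ ≤ M) →
        ∀ n : ℤ, Integrable (fun σ => ‖Wlim n σ‖) ∧ ∫ σ, ‖Wlim n σ‖ ≤ M) ∧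
      (∀ δ : ℝ, (∀ j : ℕ, δ ≤ ‖W (d j) (s j)‖) → δ ≤ ‖Wlim 0 0‖) := by
  -- the translates, their law, bound and Lipschitz constant
  set g : ℕ → ℤ → ℝ → Em m := fun j n u => W (n + d j) (u + s j) with hg_def
  have hlawg : ∀ (j : ℕ) (n : ℤ) (u : ℝ), HasDerivAt (g j n)
      (-((1 : ℝ) • g j n u) + tableQ α (g j n u) + bigLam ε₀ • tableA α (g j (n - 1) u)
        + (bigLam ε₀)⁻¹ • tableB α (g j (n + 1) u) (g j n u)) u := by
    intro j n u
    have h := (hW.law (n + d j) (u + s j)).comp_add_const u (s j)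
    have e1 : n + d j - 1 = n - 1 + d j := by ring
    have e2 : n + d j + 1 = n + 1 + d j := by ring
    rw [e1, e2] at h
    exact h
  have hbdg : ∀ (j : ℕ) (n : ℤ) (u : ℝ), ‖g j n u‖ ≤ C := fun j n u => hC _ _
  set K : ℝ := C + shiftConst α (0, 0, 0) * C ^ 2 + ‖bigLam ε₀‖ * (shiftConst α (0, 0, 1) * C ^ 2)
    + ‖(bigLam ε₀)⁻¹‖ * ((shiftConst α (1, 0, 0) + shiftConst α (0, 1, 0)) * C * C) with hK_def
  have hlipg : ∀ (j : ℕ) (n : ℤ) (u v : ℝ), ‖g j n u - g j n v‖ ≤ K * |u - v| := by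
    intro j n u v
    have h := eternal_lipschitz (hlawg j) (hbdg j) n v u
    exact h
  -- Arzelà–Ascoli (kit of ⟨22744⟩)
  set a : ℕ → ℝ := fun j => -(j : ℝ) - 1 with ha_def
  have ha : Tendsto a atTop atBot := by
    refine tendsto_atBot.2 fun b => ?_
    refine (tendsto_natCast_atTop_atTop.eventually (eventually_ge_atTop (-b))).mono fun j hj => ?_
    show -(j : ℝ) - 1 ≤ b
    linarith
  obtain ⟨φ, hφ, Wlim, hconv⟩ := exists_subseq_continuousLimit g
    (fun n _ => ⟨C, 0, fun j _ u _ => hbdg j n u⟩) (fun n _ => ⟨K, 0, fun j _ u v _ _ => hlipg j n u v⟩)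
  have ha' : Tendsto (fun j => a (φ j)) atTop atBot := ha.comp hφ.tendsto_atTop
  have hlaw' : ∀ (j : ℕ) (n : ℤ) (u : ℝ), a (φ j) < u → HasDerivAt (g (φ j) n)
      (-((1 : ℝ) • g (φ j) n u) + tableQ α (g (φ j) n u) + bigLam ε₀ • tableA α (g (φ j) (n - 1) u)
        + (bigLam ε₀)⁻¹ • tableB α (g (φ j) (n + 1) u) (g (φ j) n u)) u := fun j n u _ =>
    hlawg (φ j) n u
  have hbd' : ∀ (j : ℕ) (n : ℤ) (u : ℝ), a (φ j) < u → ‖g (φ j) n u‖ ≤ C := fun j n u _ => hbdg (φ j) n u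
  have hlaw : ∀ (n : ℤ) (σ : ℝ), HasDerivAt (Wlim n) (-((1 : ℝ) • Wlim n σ) + tableQ α (Wlim n σ)
      + bigLam ε₀ • tableA α (Wlim (n - 1) σ) + (bigLam ε₀)⁻¹ • tableB α (Wlim (n + 1) σ) (Wlim n σ)) σ :=
    fun n σ => eternalLaw_of_continuousLimit (V := fun j => g (φ j)) hlaw' hbd' ha' hconv n σ
  have hbdd : ∀ (n : ℤ) (σ : ℝ), ‖Wlim n σ‖ ≤ C := fun n σ =>
    norm_limit_le_of_receding (V := fun j => g (φ j)) hbd' ha' hconv n σ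
  -- pointwise limits and continuity
  have hpt : ∀ (n : ℤ) (σ : ℝ), Tendsto (fun j => g (φ j) n σ) atTop (𝓝 (Wlim n σ)) :=
    fun n σ => hconv n (fun _ => σ) σ tendsto_const_nhds
  have hcont : ∀ n : ℤ, Continuous (Wlim n) := fun n =>
    continuous_iff_continuousAt.2 fun σ => (hlaw n σ).continuousAt
  have hcontg : ∀ (j : ℕ) (n : ℤ), Continuous (g j n) := fun j n =>
    continuous_iff_continuousAt.2 fun u => (hlawg j n u).continuousAt
  refine ⟨φ, hφ, Wlim, hconv, hlaw, hbdd, fun M hM n => ?_, fun δ hδ => ?_⟩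
  · -- ACTION on finite windows in the limit
    have hwin : ∀ (a b : ℝ), a ≤ b → ∫ u in a..b, ‖Wlim n u‖ ≤ M := by
      intro a b hab
      have hlim : Tendsto (fun j => ∫ u in a..b, ‖g (φ j) n u‖) atTop (𝓝 (∫ u in a..b, ‖Wlim n u‖)) := by
        refine intervalIntegral.tendsto_integral_filter_of_dominated_convergence (fun _ => C) ?_ ?_
          intervalIntegrable_const ?_
        · exact Eventually.of_forall fun j => ((hcontg (φ j) n).norm).aestronglyMeasurable.restrict
        · refine Eventually.of_forall fun j => ae_of_all _ fun u _ => ?_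
          rw [norm_norm]
          exact hbdg (φ j) n u
        · exact ae_of_all _ fun u _ => (hpt n u).norm
      refine le_of_tendsto' hlim fun j => ?_
      -- the window action of a translate is a window action of `W`
      have hint := (hM (n + d (φ j))).1
      have e : ∫ u in a..b, ‖g (φ j) n u‖ = ∫ u in (a + s (φ j))..(b + s (φ j)), ‖W (n + d (φ j)) u‖ := by
        simp only [hg_def]
        rw [intervalIntegral.integral_comp_add_right (fun u => ‖W (n + d (φ j)) u‖)]
      rw [e, intervalIntegral.integral_of_le (by linarith)]
      calc ∫ u in Ioc (a + s (φ j)) (b + s (φ j)), ‖W (n + d (φ j)) u‖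
          ≤ ∫ u, ‖W (n + d (φ j)) u‖ :=
            setIntegral_le_integral hint (Eventually.of_forall fun u => norm_nonneg _)
        _ ≤ M := (hM (n + d (φ j))).2
    -- integrability on `ℝ` and the total action
    have hcn : Continuous (fun σ => ‖Wlim n σ‖) := (hcont n).norm
    have hfi : ∀ i : ℕ, IntegrableOn (fun σ => ‖Wlim n σ‖) (Ioc (-(i : ℝ)) i) := fun i =>
      (hcn.integrableOn_Icc).mono_set Ioc_subset_Icc_self
    have hai : Tendsto (fun i : ℕ => -(i : ℝ)) atTop atBot :=
      tendsto_neg_atTop_atBot.comp tendsto_natCast_atTop_atTop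
    have hbi : Tendsto (fun i : ℕ => (i : ℝ)) atTop atTop := tendsto_natCast_atTop_atTop
    have hii : ∀ i : ℕ, -(i : ℝ) ≤ i := fun i => by
      have h0 : (0 : ℝ) ≤ i := Nat.cast_nonneg i
      linarith
    have hInt : Integrable (fun σ => ‖Wlim n σ‖) := by
      refine integrable_of_intervalIntegral_norm_bounded M hfi hai hbi (Eventually.of_forall fun i => ?_)
      simp only [norm_norm]
      exact hwin _ _ (hii i)
    exact ⟨hInt, le_of_tendsto' (intervalIntegral_tendsto_integral hInt hai hbi) fun i => hwin _ _ (hii i)⟩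
  · -- floors at the centres pass to the limit
    have h0 : Tendsto (fun j => g (φ j) 0 0) atTop (𝓝 (Wlim 0 0)) := hpt 0 0
    refine ge_of_tendsto h0.norm (Eventually.of_forall fun j => ?_)
    have := hδ (φ j)
    simpa [hg_def] using this

/-- **ADMISSIBILITY OF FRONT-FOLLOWING LIMITS.** If in addition the bounded admissible eternal solution has a
TWO-SIDED geometric energy envelope `e^{2σ}‖W_n(σ)‖² ≤ Cₑ θ^n` (`θ > 0`; every admissible DSS wave has one with
`θ = e^{2T}`) and the centres keep `θ^{d_j} e^{-2 s_j} ≤ M'`, then the limit of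
`eternalLimit_of_uniformBound` is an ADMISSIBLE eternal solution, `IsEternal ε₀ α W∞`, uniformly bounded, with
envelope `e^{2σ}‖W∞_n(σ)‖² ≤ Cₑ M' θ^n`, and floors at the centres pass to `W∞_0(0)`.
[cite: Tao2016AveragedNS, §4 Lemma 4.1 (iii) (4.8)–(4.10), §6.4; KochNadirashviliSereginSverak2009, Thm 1.1 ff.; cell vocabulary (`IsEternal`, `UniformBound`)] -/
theorem admissibleEternalLimit_of_envelope {ε₀ θ Cₑ M' : ℝ} {α : Fin m → Fin m → Fin m → ℤ × ℤ × ℤ → ℝ}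
    {W : ℤ → ℝ → Em m} (hW : IsEternal ε₀ α W) {C : ℝ} (hC : ∀ (n : ℤ) (σ : ℝ), ‖W n σ‖ ≤ C)
    (hθ : 0 < θ) (henv : ∀ (n : ℤ) (σ : ℝ), Real.exp (2 * σ) * ‖W n σ‖ ^ 2 ≤ Cₑ * θ ^ n)
    (d : ℕ → ℤ) (s : ℕ → ℝ) (hM' : ∀ j : ℕ, θ ^ (d j) * Real.exp (-(2 * s j)) ≤ M') :
    ∃ φ : ℕ → ℕ, StrictMono φ ∧ ∃ Wlim : ℤ → ℝ → Em m,
      (∀ (n : ℤ) (u : ℕ → ℝ) (σ : ℝ), Tendsto u atTop (𝓝 σ) →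
        Tendsto (fun j => W (n + d (φ j)) (u j + s (φ j))) atTop (𝓝 (Wlim n σ))) ∧
      IsEternal ε₀ α Wlim ∧ UniformBound Wlim ∧ (∀ (n : ℤ) (σ : ℝ), ‖Wlim n σ‖ ≤ C) ∧
      (∀ (n : ℤ) (σ : ℝ), Real.exp (2 * σ) * ‖Wlim n σ‖ ^ 2 ≤ Cₑ * M' * θ ^ n) ∧
      (∀ δ : ℝ, (∀ j : ℕ, δ ≤ ‖W (d j) (s j)‖) → δ ≤ ‖Wlim 0 0‖) := by
  obtain ⟨φ, hφ, Wlim, hconv, hlaw, hbdd, hact, hfloor⟩ := eternalLimit_of_uniformBound hW hC d s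
  have hpt : ∀ (n : ℤ) (σ : ℝ), Tendsto (fun j => W (n + d (φ j)) (σ + s (φ j))) atTop (𝓝 (Wlim n σ)) :=
    fun n σ => hconv n (fun _ => σ) σ tendsto_const_nhds
  -- `Cₑ ≥ 0`
  have hCₑ : 0 ≤ Cₑ := by
    have h0 := henv 0 0
    have h1 : 0 ≤ Real.exp (2 * (0 : ℝ)) * ‖W 0 0‖ ^ 2 := by positivity
    have h2 : Cₑ * θ ^ (0 : ℤ) = Cₑ := by simp
    rw [h2] at h0
    exact h1.trans h0
  -- ENVELOPE in the limit
  have henv' : ∀ (n : ℤ) (σ : ℝ), Real.exp (2 * σ) * ‖Wlim n σ‖ ^ 2 ≤ Cₑ * M' * θ ^ n := by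
    intro n σ
    have hq : 0 < θ ^ n := zpow_pos hθ _
    refine le_of_tendsto ((((hpt n σ).norm).pow 2).const_mul (Real.exp (2 * σ)))
      (Eventually.of_forall fun j => ?_)
    have h1 := henv (n + d (φ j)) (σ + s (φ j))
    have hexp : Real.exp (2 * σ) = Real.exp (-(2 * s (φ j))) * Real.exp (2 * (σ + s (φ j))) := by
      rw [← Real.exp_add]; ring_nf
    have hz : θ ^ (n + d (φ j)) = θ ^ n * θ ^ (d (φ j)) := zpow_add₀ hθ.ne' _ _
    calc Real.exp (2 * σ) * ‖W (n + d (φ j)) (σ + s (φ j))‖ ^ 2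
        = Real.exp (-(2 * s (φ j))) * (Real.exp (2 * (σ + s (φ j))) * ‖W (n + d (φ j)) (σ + s (φ j))‖ ^ 2) := by
          rw [hexp, mul_assoc]
      _ ≤ Real.exp (-(2 * s (φ j))) * (Cₑ * θ ^ (n + d (φ j))) :=
          mul_le_mul_of_nonneg_left h1 (Real.exp_pos _).le
      _ = (θ ^ (d (φ j)) * Real.exp (-(2 * s (φ j)))) * (Cₑ * θ ^ n) := by rw [hz]; ring
      _ ≤ M' * (Cₑ * θ ^ n) := mul_le_mul_of_nonneg_right (hM' (φ j)) (mul_nonneg hCₑ hq.le)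
      _ = Cₑ * M' * θ ^ n := by ring
  obtain ⟨M, hM⟩ := hW.action
  refine ⟨φ, hφ, Wlim, hconv, ⟨hlaw, ⟨M, hact M hM⟩, fun n => ⟨0, Cₑ * M' * θ ^ n, fun σ _ => henv' n σ⟩⟩,
    ⟨C, hbdd⟩, hbdd, henv', hfloor⟩

/-- **Every admissible DSS wave, read shell-wise, has a two-sided geometric energy envelope** with ratio
`θ = e^{2T}`: `e^{2σ}‖(dssEmbed π T Φ r₀)_n(σ)‖² ≤ Cₑ (e^{2T})^n`, where `Cₑ` bounds `e^{2x}‖Φ_r(x)‖²` on all of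
`ℝ` (forward by the `bdd` clause, backward by the bounded profiles `IsDSSWave.uniformBound`). So DSS waves lie in
the hypothesis class of `admissibleEternalLimit_of_envelope`.
[cite: Tao2016AveragedNS, §4 Lemma 4.1 (4.8)–(4.10) in self-similar variables; cell vocabulary (`IsDSSWave`, `dssEmbed`)] -/
theorem dssEmbed_envelope {ρ : Type*} [Fintype ρ] {ε₀ T : ℝ} {α : Fin m → Fin m → Fin m → ℤ × ℤ × ℤ → ℝ}
    {π : Equiv.Perm ρ} {Φ : ρ → ℝ → Em m} (h : IsDSSWave ε₀ α π T Φ) :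
    ∃ Cₑ : ℝ, ∀ (r₀ : ρ) (n : ℤ) (σ : ℝ),
      Real.exp (2 * σ) * ‖dssEmbed π T Φ r₀ n σ‖ ^ 2 ≤ Cₑ * Real.exp (2 * T) ^ n := by
  obtain ⟨C, hC⟩ := h.uniformBound
  obtain ⟨x₀, P, hP⟩ := h.bdd
  -- a bound for `e^{2x}‖Φ_r(x)‖²` on all of `ℝ`
  refine ⟨Real.exp (2 * x₀) * C ^ 2 + |P|, fun r₀ n σ => ?_⟩
  have hall : ∀ (r : ρ) (x : ℝ), Real.exp (2 * x) * ‖Φ r x‖ ^ 2 ≤ Real.exp (2 * x₀) * C ^ 2 + |P| := by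
    intro r x
    rcases le_total x x₀ with hx | hx
    · have h1 : Real.exp (2 * x) ≤ Real.exp (2 * x₀) := Real.exp_le_exp.2 (by linarith)
      have h2 : ‖Φ r x‖ ^ 2 ≤ C ^ 2 := pow_le_pow_left₀ (norm_nonneg _) (hC r x) 2
      have h3 := mul_le_mul h1 h2 (by positivity) (Real.exp_pos _).le
      linarith [abs_nonneg P]
    · have hw := hP x hx
      unfold wEnergy at hw
      have h1 : ‖Φ r x‖ ^ 2 ≤ sEnergy Φ x :=
        Finset.single_le_sum (f := fun r' => ‖Φ r' x‖ ^ 2) (fun _ _ => sq_nonneg _) (Finset.mem_univ r)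
      have h2 : Real.exp (2 * x) * ‖Φ r x‖ ^ 2 ≤ P := by
        have e : Real.exp (2 * 1 * x) = Real.exp (2 * x) := by ring_nf
        rw [e] at hw
        exact (mul_le_mul_of_nonneg_left h1 (Real.exp_pos _).le).trans hw
      have : 0 ≤ Real.exp (2 * x₀) * C ^ 2 := by positivity
      linarith [le_abs_self P]
  have hexp : Real.exp (2 * σ) = Real.exp (2 * T) ^ n * Real.exp (2 * (σ - n * T)) := by
    rw [← Real.rpow_intCast, ← Real.exp_mul, ← Real.exp_add]; ring_nf
  simp only [dssEmbed]
  rw [hexp, mul_assoc, mul_comm (Real.exp (2 * T) ^ n)]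
  exact mul_le_mul_of_nonneg_right (hall _ _) (zpow_pos (Real.exp_pos _) _).le

end BlowupRigidityOne

end Summit.NavierStokesRegularity.NavierStokesRegularity.Theorems

end
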